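import Literature.AlgebraicGeometry.HodgeTheory.QuaternionicQuarticIrreducible
import Literature.AlgebraicGeometry.Motives.SmoothHypersurfaceIrreducible
import Literature.AlgebraicGeometry.Morphisms.SubschemeIntegral
import HarnessLib

/-!
# The universal quaternionic quartic `𝒱 = V₊(Q_e) ⊂ ℙ³_A → Spec A` over the parameter ring `A = ℂ[a]`

Layer `Literature/AlgebraicGeometry/HodgeTheory`. Definitions + proved API (no named fact). Written by the
prover seat `hodge-nonav-19716-p2` (g13, cell `hodge-nonav`) as brick **QF-1b «COVER», clause (C1)** of
prover-Bx's programme Q-FAMILY (memo `PROGRAMME-Q-FAMILY-Bx-g18.md` §6–§7; interface of 2026-08-29T07:40:58Z)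
for route `HodgeConjecture/Q8SymplecticPowers` (crux K1Q, stmt-HodgeConjecture-24190): the input `P → Spec A`
of the spreading theorem `Limits.exists_projectiveModel_birational` (QF-5a).

With `A = ParamRing e = ℂ[a_i | i ∈ CIdx e]` the coordinate ring of the parameter space `𝔸^{CIdx e}` of
`Q8Family.base` (`QuaternionicQuarticFamily`):

* `cOfR`, `ψOfR`, `quarticFormR` — the forms `c`, `ψ = ψ₀ + σ^*ψ₀` and
  `x₃⁴ x₂^{2e} − c (σc)³ ((x₀ − x₁) ψ)²` of a coefficient vector with values in ANY commutative ring
  (over `ℂ` they are `cOf`, `ψOf`, `quarticForm` by `rfl`), their naturality under ring maps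
  (`map_cOfR`, `map_ψOfR`, `map_quarticFormR`) and homogeneity (`isHomogeneous_quarticFormR`, degree
  `2e + 4` for `e ≥ 1`);
* `univQ e ∈ A[x₀, …, x₃]` — **the universal quaternionic quartic**, the form of the universal pair whose
  coefficients are the coordinate functions; `map_univQ` / `map_univQ_eq_quarticForm`: along
  `φ : A → R` it specialises to the form of the vector `(φ (X i))_i` — over a complex point literally to
  the route's `quarticForm e (cOf a) (ψOf a)` with `a = coeffs W t`;
* `cover e : SchemeOver A` — **the cover `𝒱 = V₊(Q_e) ↪ ℙ³_A → Spec A`** with the REDUCED INDUCED closed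
  subscheme structure (Mathlib `IdealSheafData.vanishingIdeal`, the idiom of
  `UniversalHypersurface.totalSpace`; Mathlib has no graded quotient `Proj A[x]/(Q)`), its closed immersion
  `coverEmb e : (cover e).left ⟶ ℙ³_A` with image `V₊(Q_e)` (`range_coverEmb`), and the instances a
  consumer of `Limits.LocApprox` needs: `IsProper`, `QuasiCompact`, `QuasiSeparated`, `LocallyOfFiniteType`,
  `LocallyOfFinitePresentation` (`Spec A` is Noetherian) for `(cover e).hom`, `IsReduced (cover e).left`;
* for a ring-valued point `φ : A → L`: `projMapOfHom`, `isPullback_projMapOfHom` (`ℙ³_L = ℙ³_A ×_A Spec L`,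
  any algebra, `ProjBaseChangeRing.isPullback_projMap'`), and **the fibre `𝒱_φ = 𝒱 ×_A Spec L`**
  (`pullback (cover e).hom (Spec.map φ)`; for `φ = algebraMap A K` this is `(cover e ⊗ specOver A K).left`
  on the nose) with its closed immersion `fiberEmb e φ : 𝒱_φ ⟶ ℙ³_L` over `Spec L`
  (`isClosedImmersion_fiberEmb`, `fiberEmb_comp_projSpToSpec`), a base change of `𝒱 ↪ ℙ³_A`
  (`isPullback_fiberEmb`), with image `V₊(Q_φ)` (`range_fiberEmb`); hence `𝒱_φ` is IRREDUCIBLE over every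
  field-valued point at which the specialised form `Q_φ` is prime (`irreducibleSpace_fiber`, via
  `SmoothHypersurface.isIrreducible_zeroLocus_of_prime`).

Reducedness of the field fibres (they are fibres of a reduced scheme, not automatically reduced), the
generic fibre's integrality / geometric irreducibility / dimension (clause (C2)) and the complex-point fibres
(clause (C3)) are in the companion files `QuaternionicQuarticCoverGeneric` / `…Fibres`. Honest scope: scheme
bookkeeping for one explicit family of quartic surfaces; nothing here bears on HC.

## References

* [EGAIV3] A. Grothendieck, J. Dieudonné, EGA IV₃ (1966), §8 (the cover as the input of spreading out).
* [Hartshorne1977] R. Hartshorne, Algebraic Geometry (1977): II Example 3.2.6 (reduced induced structure),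
  II Thm. 4.9 (projective ⇒ proper), II Ex. 2.9 (irreducible hypersurfaces), II Ex. 3.11 (a).
* [Liu2002] Q. Liu, Algebraic Geometry and Arithmetic Curves (2002), Prop. 3.1.9, Ex. 3.1.10 (`ℙⁿ_L = ℙⁿ_A ×_A L`).
* [GortzWedhorn2020] U. Görtz, T. Wedhorn, Algebraic Geometry I, 2nd ed. (2020), Prop. 3.27.
* [Kollar2007] J. Kollár, Lectures on Resolution of Singularities (2007), §3.3 (the family's equation).
-/

noncomputable section

open CategoryTheory AlgebraicGeometry MvPolynomial Limits TopologicalSpace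
open Literature.AlgebraicGeometry.Motives Literature.AlgebraicGeometry.Motives.UniversalHypersurface

universe v

namespace Literature.AlgebraicGeometry.HodgeTheory.Q8Family

/-! ### The forms over an arbitrary commutative ring -/

section Forms

variable {R : Type v} [CommRing R] {S : Type*} [CommRing S] {e : ℕ}

/-- The linear form `c = Σ_{|d| = 1} a_d x^d` of a coefficient vector `a` with values in ANY commutative
ring (`cOf` is the case `R = ℂ`, `cOfR_eq_cOf`). [cite: Kollar2007, §3.3] -/
def cOfR (a : CIdx e → R) : MvPolynomial (Fin 3) R :=
  ∑ d : DegIndex 1 1, monomial d.1 (a (Sum.inl d))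

/-- The σ-invariant form `ψ = ψ₀ + σ^*ψ₀` of a coefficient vector with values in any commutative ring
(`ψOf` is the case `R = ℂ`). [cite: Kollar2007, §3.3] -/
def ψOfR (a : CIdx e → R) : MvPolynomial (Fin 3) R :=
  (∑ d : DegIndex 1 (e - 1), monomial d.1 (a (Sum.inr d))) +
    rename (Equiv.swap (0 : Fin 3) 1) (∑ d : DegIndex 1 (e - 1), monomial d.1 (a (Sum.inr d)))

variable (e) in
/-- The quaternionic quartic form `x₃⁴ x₂^{2e} − c (σc)³ ((x₀ − x₁) ψ)²` over any commutative ring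
(`quarticForm` is the case `R = ℂ`, `quarticFormR_eq_quarticForm`). [cite: Kollar2007, §3.3] -/
def quarticFormR (c ψ : MvPolynomial (Fin 3) R) : MvPolynomial (Fin 4) R :=
  X (Fin.last 3) ^ 4 * X (Fin.castSucc 2) ^ (2 * e) -
    rename Fin.castSucc (c * rename (Equiv.swap (0 : Fin 3) 1) c ^ 3 * ((X 0 - X 1) * ψ) ^ 2)

/-- Over `ℂ`, `cOfR = cOf` (`rfl`). [cite: Kollar2007, §3.3] -/
theorem cOfR_eq_cOf (a : CIdx e → ℂ) : cOfR a = cOf a := rfl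

/-- Over `ℂ`, `ψOfR = ψOf` (`rfl`). [cite: Kollar2007, §3.3] -/
theorem ψOfR_eq_ψOf (a : CIdx e → ℂ) : ψOfR a = ψOf a := rfl

/-- Over `ℂ`, `quarticFormR = quarticForm` (`rfl`). [cite: Kollar2007, §3.3] -/
theorem quarticFormR_eq_quarticForm (c ψ : MvPolynomial (Fin 3) ℂ) :
    quarticFormR e c ψ = quarticForm e c ψ := rfl

/-- `cOfR` is natural in the coefficient ring. [cite: Lang2002, Ch. IV §1 (functoriality of polynomial rings in the coefficients)] -/
theorem map_cOfR (f : R →+* S) (a : CIdx e → R) : map f (cOfR a) = cOfR (f ∘ a) := by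
  simp [cOfR, map_monomial]

/-- `ψOfR` is natural in the coefficient ring. [cite: Lang2002, Ch. IV §1 (functoriality of polynomial rings in the coefficients)] -/
theorem map_ψOfR (f : R →+* S) (a : CIdx e → R) : map f (ψOfR a) = ψOfR (f ∘ a) := by
  simp [ψOfR, map_monomial, map_rename]

/-- `quarticFormR` is natural in the coefficient ring. [cite: Lang2002, Ch. IV §1 (functoriality of polynomial rings in the coefficients)] -/
theorem map_quarticFormR (f : R →+* S) (c ψ : MvPolynomial (Fin 3) R) :
    map f (quarticFormR e c ψ) = quarticFormR e (map f c) (map f ψ) := by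
  simp [quarticFormR, map_rename, map_X]

/-- `cOfR a` is a linear form. [cite: Hartshorne1977, I §2 (p. 9, the grading of S = k[x₀,…,xₙ])] -/
theorem isHomogeneous_cOfR (a : CIdx e → R) : (cOfR a).IsHomogeneous 1 :=
  IsHomogeneous.sum _ _ _ fun d _ => isHomogeneous_monomial _ d.2

/-- `ψOfR a` is a form of degree `e − 1`. [cite: Hartshorne1977, I §2 (p. 9, the grading of S = k[x₀,…,xₙ])] -/
theorem isHomogeneous_ψOfR (a : CIdx e → R) : (ψOfR a).IsHomogeneous (e - 1) := by
  have h : (∑ d : DegIndex 1 (e - 1), monomial d.1 (a (Sum.inr d)) : MvPolynomial (Fin 3) R).IsHomogeneous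
      (e - 1) :=
    IsHomogeneous.sum _ _ _ fun d _ => isHomogeneous_monomial _ d.2
  exact h.add (h.rename_isHomogeneous)

/-- For `e ≥ 1`, a linear `c` and `ψ` of degree `e − 1`, the quaternionic quartic form is homogeneous of
degree `2e + 4`. [cite: Hartshorne1977, I §2 (p. 9, the grading of S = k[x₀,…,xₙ])] -/
theorem isHomogeneous_quarticFormR (he : 1 ≤ e) {c ψ : MvPolynomial (Fin 3) R} (hc : c.IsHomogeneous 1)
    (hψ : ψ.IsHomogeneous (e - 1)) : (quarticFormR e c ψ).IsHomogeneous (2 * e + 4) := by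
  have h1 : (X (Fin.last 3) ^ 4 * X (Fin.castSucc 2) ^ (2 * e) : MvPolynomial (Fin 4) R).IsHomogeneous
      (2 * e + 4) := by
    have := ((isHomogeneous_X R (Fin.last 3)).pow 4).mul ((isHomogeneous_X R (Fin.castSucc (2 : Fin 3))).pow (2 * e))
    convert this using 1
    ring
  have h01 : (X 0 - X 1 : MvPolynomial (Fin 3) R).IsHomogeneous 1 :=
    (isHomogeneous_X R 0).sub (isHomogeneous_X R 1)
  have h2 : (c * rename (Equiv.swap (0 : Fin 3) 1) c ^ 3 * ((X 0 - X 1) * ψ) ^ 2).IsHomogeneous (2 * e + 4) := by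
    have := (hc.mul ((hc.rename_isHomogeneous (f := Equiv.swap (0 : Fin 3) 1)).pow 3)).mul ((h01.mul hψ).pow 2)
    convert this using 1
    omega
  exact h1.sub h2.rename_isHomogeneous

end Forms

/-! ### The universal form over `A = ℂ[a_i | i ∈ CIdx e]` -/

section Universal

variable (e : ℕ)

/-- The parameter ring `A = ℂ[a_i | i ∈ CIdx e]` of the quaternionic quartic family (the coordinate ring of
the affine space `𝔸^{CIdx e}` of `Q8Family.base`). [folklore] -/
abbrev ParamRing : Type := MvPolynomial (CIdx e) ℂ

/-- **The universal quaternionic quartic** `Q_e ∈ A[x₀, …, x₃]`: the form of the universal pair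
`(c, ψ) = (Σ a_d x^d, ψ₀ + σ^*ψ₀)` whose coefficients are the coordinate functions `a_i`. [cite: Kollar2007, §3.3] -/
def univQ : MvPolynomial (Fin 4) (ParamRing e) :=
  quarticFormR e (cOfR fun i => (X i : ParamRing e)) (ψOfR fun i => (X i : ParamRing e))

/-- Specialising the universal form along `φ : A → R` gives the form of the coefficient vector `φ ∘ a`.
[cite: Lang2002, Ch. IV §1 (functoriality of polynomial rings in the coefficients)] -/
theorem map_univQ {R : Type v} [CommRing R] (φ : ParamRing e →+* R) :
    map φ (univQ e) = quarticFormR e (cOfR fun i => φ (X i)) (ψOfR fun i => φ (X i)) := by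
  rw [univQ, map_quarticFormR, map_cOfR, map_ψOfR]
  rfl

/-- Over a complex point `φ : A → ℂ` the universal form specialises to the route's
`quarticForm e (cOf a) (ψOf a)`, `a = φ ∘ X`. [cite: Kollar2007, §3.3] -/
theorem map_univQ_eq_quarticForm (φ : ParamRing e →+* ℂ) :
    map φ (univQ e) = quarticForm e (cOf fun i => φ (X i)) (ψOf fun i => φ (X i)) :=
  map_univQ e φ

/-- The universal form is homogeneous of degree `2e + 4` (`e ≥ 1`). [cite: Hartshorne1977, I §2 (p. 9, the grading of S = k[x₀,…,xₙ])] -/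
theorem isHomogeneous_univQ (he : 1 ≤ e) : (univQ e).IsHomogeneous (2 * e + 4) :=
  isHomogeneous_quarticFormR he (isHomogeneous_cOfR _) (isHomogeneous_ψOfR _)

end Universal

/-! ### The cover `𝒱 = V₊(Q_e) ⊂ ℙ³_A → Spec A` -/

section Cover

variable (e : ℕ)

attribute [local instance] MvPolynomial.gradedAlgebra

/-- `ℙ³_R → Spec R` is proper for every commutative ring `R` (Hartshorne II Thm. 4.9;
`ProjBaseChangeRing.isProper_projToSpec`). The spelling `projSp 2 R = Proj R[x₀,…,x₃]`, `projSpToSpec 2 R` is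
the tree's (`Motives.UniversalHypersurface`), whose own instance covers only `R = CoeffRing k n d`.
[cite: Hartshorne1977, II Thm. 4.9] -/
instance isProper_projSpToSpec_two (R : Type v) [CommRing R] : IsProper (projSpToSpec 2 R) :=
  ProjBaseChangeRing.isProper_projToSpec (Fin (2 + 2)) R

/-- The closed subset `V₊(Q_e) ⊆ ℙ³_A` of the universal quaternionic quartic. [folklore] -/
def zeroLocusClosed : Closeds (projSp 2 (ParamRing e)) :=
  ⟨ProjectiveSpectrum.zeroLocus ((homogeneousSubmodule (Fin (2 + 2)) (ParamRing e))) {univQ e}, ProjectiveSpectrum.isClosed_zeroLocus _ _⟩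

/-- Unfolding `zeroLocusClosed` (`rfl`). [cite: Hartshorne1977, II §2 (p. 76, the closed sets V(𝔞) of Proj S)] -/
@[simp]
theorem coe_zeroLocusClosed :
    (zeroLocusClosed e : Set (projSp 2 (ParamRing e))) =
      ProjectiveSpectrum.zeroLocus ((homogeneousSubmodule (Fin (2 + 2)) (ParamRing e))) {univQ e} := rfl

/-- The ideal sheaf of the **reduced induced structure** on `V₊(Q_e)` (Mathlib `IdealSheafData.vanishingIdeal`;
Hartshorne II Example 3.2.6) — the idiom of `UniversalHypersurface.idealSheaf`. [folklore] -/
def idealSheaf : (projSp 2 (ParamRing e)).IdealSheafData :=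
  Scheme.IdealSheafData.vanishingIdeal (zeroLocusClosed e)

/-- **The cover `𝒱 → Spec A`** of the programme Q-FAMILY (brick QF-1, clause (C1)): the universal
quaternionic quartic `𝒱 = V₊(Q_e) ↪ ℙ³_A → Spec A` (reduced induced closed subscheme structure on `V₊(Q_e)`)
as an `A`-scheme, `A = ℂ[a_i | i ∈ CIdx e]`. [cite: EGAIV3, §8] -/
def cover : SchemeOver (ParamRing e) :=
  Over.mk ((idealSheaf e).subschemeι ≫ projSpToSpec 2 (ParamRing e))

/-- The underlying scheme `𝒱` of the cover is the closed subscheme of the ideal sheaf (`rfl`). [cite: Hartshorne1977, II Example 3.2.6] -/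
theorem cover_left : (cover e).left = (idealSheaf e).subscheme := rfl

/-- **The closed immersion `𝒱 ↪ ℙ³_A`** (Mathlib `IdealSheafData.subschemeι`, typed on `(cover e).left`).
[folklore] -/
abbrev coverEmb : (cover e).left ⟶ projSp 2 (ParamRing e) := (idealSheaf e).subschemeι

/-- The structure morphism of the cover is `𝒱 ↪ ℙ³_A → Spec A` (`rfl`). [cite: Hartshorne1977, II Example 3.2.6] -/
theorem cover_hom : (cover e).hom = coverEmb e ≫ projSpToSpec 2 (ParamRing e) := rfl

/-- `𝒱 ↪ ℙ³_A` is a closed immersion (Mathlib's instance for `subschemeι`). [folklore] -/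
instance isClosedImmersion_coverEmb : IsClosedImmersion (coverEmb e) :=
  inferInstanceAs (IsClosedImmersion (idealSheaf e).subschemeι)

/-- `𝒱 → Spec A` is proper (a closed immersion followed by the proper `ℙ³_A → Spec A`). [folklore] -/
instance isProper_cover_hom : IsProper (cover e).hom := by
  rw [cover_hom]; infer_instance

/-- `𝒱 → Spec A` is quasi-compact. [folklore] -/
instance quasiCompact_cover_hom : QuasiCompact (cover e).hom := inferInstance

/-- `𝒱 → Spec A` is quasi-separated. [folklore] -/
instance quasiSeparated_cover_hom : QuasiSeparated (cover e).hom := inferInstance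

/-- `𝒱 → Spec A` is locally of finite type. [folklore] -/
instance locallyOfFiniteType_cover_hom : LocallyOfFiniteType (cover e).hom := inferInstance

/-- `Spec A` is locally Noetherian (`A` is a polynomial ring in finitely many variables over `ℂ`). [folklore] -/
instance isLocallyNoetherian_spec_paramRing : IsLocallyNoetherian (Spec (.of (ParamRing e))) :=
  (isLocallyNoetherian_Spec (R := .of (ParamRing e))).mpr (inferInstanceAs (IsNoetherianRing (ParamRing e)))

/-- `𝒱 → Spec A` is locally of finite presentation (finite type over a Noetherian base). [folklore] -/
instance locallyOfFinitePresentation_cover_hom : LocallyOfFinitePresentation (cover e).hom := inferInstance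

/-- The support of the ideal sheaf of `𝒱` is `V₊(Q_e)`. [cite: Hartshorne1977, II Example 3.2.6] -/
theorem coe_support_idealSheaf :
    ((idealSheaf e).support : Set (projSp 2 (ParamRing e))) =
      ProjectiveSpectrum.zeroLocus ((homogeneousSubmodule (Fin (2 + 2)) (ParamRing e))) {univQ e} := by
  rw [idealSheaf, Scheme.IdealSheafData.coe_support_vanishingIdeal]
  rfl

/-- **The image of `𝒱 ↪ ℙ³_A` is `V₊(Q_e)`.** [cite: Hartshorne1977, II Example 3.2.6] -/
theorem range_coverEmb :
    Set.range (coverEmb e) = ProjectiveSpectrum.zeroLocus ((homogeneousSubmodule (Fin (2 + 2)) (ParamRing e))) {univQ e} := by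
  refine (Scheme.IdealSheafData.range_subschemeι (idealSheaf e)).trans ?_
  rw [coe_support_idealSheaf]

/-- A vanishing ideal sheaf is radical (local copy of `Literature.AlgebraicGeometry.Resolution.radical_vanishingIdeal`
of `Resolution/NormalCrossingsLocal`, kept private to avoid that file's imports). [cite: GortzWedhorn2020, Prop. 3.27] -/
private theorem radical_vanishingIdeal {Y : Scheme.{v}} (Z : Closeds Y) :
    (Scheme.IdealSheafData.vanishingIdeal Z).radical = Scheme.IdealSheafData.vanishingIdeal Z := by
  refine le_antisymm (fun U => ?_) (Scheme.IdealSheafData.le_radical _)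
  rw [Scheme.IdealSheafData.radical_ideal, Scheme.IdealSheafData.vanishingIdeal_ideal]
  exact PrimeSpectrum.isRadical_vanishingIdeal _

/-- **`𝒱` is reduced** (reduced induced structure: its ideal sheaf is radical). [cite: GortzWedhorn2020, Prop. 3.27] -/
instance isReduced_cover_left : IsReduced (cover e).left :=
  Morphisms.isReduced_subscheme (idealSheaf e) (radical_vanishingIdeal (zeroLocusClosed e))

end Cover

/-! ### The fibres over ring-valued points `φ : A → L` as closed subschemes of `ℙ³_L` -/

section Fibre

variable (e : ℕ) {L : Type} [CommRing L] (φ : ParamRing e →+* L)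

attribute [local instance] MvPolynomial.gradedAlgebra

/-- The base change `ℙ³_L → ℙ³_A` along `φ : A → L` (Mathlib `Proj.map` of `A[x] → L[x]`). [folklore] -/
def projMapOfHom : projSp 2 L ⟶ projSp 2 (ParamRing e) :=
  letI : Algebra (ParamRing e) L := φ.toAlgebra
  Proj.map (ProjBaseChangeRing.mapGraded (ParamRing e) L (Fin (2 + 2)))
    (ProjBaseChangeRing.irrelevant_le_map (ParamRing e) L (Fin (2 + 2)))

/-- **`ℙ³_L = ℙ³_A ×_A Spec L`** along `φ` (`ProjBaseChangeRing.isPullback_projMap'`, any algebra;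
Liu 2002 Prop. 3.1.9). [cite: Liu2002, Prop. 3.1.9 and Ex. 3.1.10] -/
theorem isPullback_projMapOfHom :
    IsPullback (projMapOfHom e φ) (projSpToSpec 2 L) (projSpToSpec 2 (ParamRing e))
      (Spec.map (CommRingCat.ofHom φ)) := by
  letI : Algebra (ParamRing e) L := φ.toAlgebra
  exact ProjBaseChangeRing.isPullback_projMap' (ParamRing e) L

/-- On points `projMapOfHom φ` contracts homogeneous primes along `A[x] → L[x]`: `G ∈ 𝔭_{image}` iff
`φ(G) ∈ 𝔭` (definition of `Proj.map`). [cite: Liu2002, Prop. 3.1.9] -/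
theorem mem_projMapOfHom_apply_iff (q : projSp 2 L) (G : MvPolynomial (Fin 4) (ParamRing e)) :
    G ∈ (projMapOfHom e φ q).asHomogeneousIdeal ↔ MvPolynomial.map φ G ∈ q.asHomogeneousIdeal :=
  Iff.rfl

/-- **The embedding `𝒱_φ ⟶ ℙ³_L` of the fibre `𝒱_φ = 𝒱 ×_A Spec L`** over `φ`: the morphism to
`ℙ³_L = ℙ³_A ×_A Spec L` with components `𝒱_φ → 𝒱 ↪ ℙ³_A` and `𝒱_φ → Spec L`. [folklore] -/
def fiberEmb : pullback (cover e).hom (Spec.map (CommRingCat.ofHom φ)) ⟶ projSp 2 L :=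
  (isPullback_projMapOfHom e φ).lift
    (pullback.fst (cover e).hom (Spec.map (CommRingCat.ofHom φ)) ≫ coverEmb e)
    (pullback.snd (cover e).hom (Spec.map (CommRingCat.ofHom φ)))
    (by rw [Category.assoc]; exact pullback.condition)

/-- `fiberEmb` followed by `ℙ³_L → ℙ³_A` is `𝒱_φ → 𝒱 ↪ ℙ³_A`. [cite: Hartshorne1977, II Ex. 3.11 (a)] -/
@[reassoc]
theorem fiberEmb_comp_projMapOfHom :
    fiberEmb e φ ≫ projMapOfHom e φ =
      pullback.fst (cover e).hom (Spec.map (CommRingCat.ofHom φ)) ≫ coverEmb e :=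
  IsPullback.lift_fst _ _ _ _

/-- `fiberEmb` followed by `ℙ³_L → Spec L` is the projection `𝒱_φ → Spec L`. [cite: Hartshorne1977, II Ex. 3.11 (a)] -/
@[reassoc]
theorem fiberEmb_comp_projSpToSpec :
    fiberEmb e φ ≫ projSpToSpec 2 L = pullback.snd (cover e).hom (Spec.map (CommRingCat.ofHom φ)) :=
  IsPullback.lift_snd _ _ _ _

/-- **`𝒱_φ ⊆ ℙ³_L` is the base change of `𝒱 ⊆ ℙ³_A`** along `ℙ³_L → ℙ³_A`. [cite: Hartshorne1977, II Ex. 3.11 (a)] -/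
theorem isPullback_fiberEmb :
    IsPullback (pullback.fst (cover e).hom (Spec.map (CommRingCat.ofHom φ))) (fiberEmb e φ) (coverEmb e)
      (projMapOfHom e φ) := by
  refine IsPullback.of_bot ?_ (fiberEmb_comp_projMapOfHom e φ).symm (isPullback_projMapOfHom e φ)
  rw [fiberEmb_comp_projSpToSpec]
  exact IsPullback.of_hasPullback (cover e).hom (Spec.map (CommRingCat.ofHom φ))

/-- `𝒱_φ ⟶ ℙ³_L` is a closed immersion (base change of `𝒱 ↪ ℙ³_A`). [folklore] -/
instance isClosedImmersion_fiberEmb : IsClosedImmersion (fiberEmb e φ) :=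
  MorphismProperty.of_isPullback (P := @IsClosedImmersion) (isPullback_fiberEmb e φ) inferInstance

/-- **The fibre `𝒱_φ` has support `V₊(Q_φ) ⊆ ℙ³_L`**, `Q_φ = φ(Q_e)` the specialised form. [cite: Hartshorne1977, II Ex. 3.11 (a)] -/
theorem range_fiberEmb :
    Set.range (fiberEmb e φ) = ProjectiveSpectrum.zeroLocus ((homogeneousSubmodule (Fin (2 + 2)) L)) {MvPolynomial.map φ (univQ e)} := by
  have h := isPullback_fiberEmb e φ
  have hsurj : Function.Surjective h.isoPullback.hom := h.isoPullback.hom.homeomorph.surjective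
  have hr : Set.range (fiberEmb e φ) = Set.range (pullback.snd (coverEmb e) (projMapOfHom e φ)) := by
    rw [← h.isoPullback_hom_snd]
    ext y
    simp only [Set.mem_range]
    constructor
    · rintro ⟨x, rfl⟩
      exact ⟨_, rfl⟩
    · rintro ⟨x, rfl⟩
      obtain ⟨x', rfl⟩ := hsurj x
      exact ⟨x', rfl⟩
  rw [hr, Scheme.Pullback.range_snd, range_coverEmb]
  ext x
  change ({univQ e} : Set _) ⊆ _ ↔ ({MvPolynomial.map φ (univQ e)} : Set _) ⊆ _
  rw [Set.singleton_subset_iff, Set.singleton_subset_iff, SetLike.mem_coe, SetLike.mem_coe]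
  exact mem_projMapOfHom_apply_iff e φ x _

/-- **The fibre `𝒱_φ` over a field-valued point with `Q_φ` prime is irreducible** (`e ≥ 1`): its closed
embedding into `ℙ³_L` has image the irreducible hypersurface `V₊(Q_φ)`
(`SmoothHypersurface.isIrreducible_zeroLocus_of_prime`). [cite: Hartshorne1977, II Ex. 2.9] -/
theorem irreducibleSpace_fiber {L : Type} [Field L] (φ : ParamRing e →+* L) (he : 1 ≤ e)
    (hprime : Prime (MvPolynomial.map φ (univQ e))) :
    IrreducibleSpace ↑(pullback (cover e).hom (Spec.map (CommRingCat.ofHom φ))) := by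
  have hirr : IsIrreducible (Set.range (fiberEmb e φ)) := by
    rw [range_fiberEmb]
    exact SmoothHypersurface.isIrreducible_zeroLocus_of_prime (n := 2) _
      ((isHomogeneous_univQ e he).map φ) hprime
  haveI : IrreducibleSpace (Set.range (fiberEmb e φ)) := Subtype.irreducibleSpace hirr
  exact (fiberEmb e φ).isClosedEmbedding.isEmbedding.toHomeomorph.irreducibleSpace_iff.mpr this

end Fibre

end Literature.AlgebraicGeometry.HodgeTheory.Q8Family

end
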